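import Literature.NumberTheory.EllipticCurves.PAdicDistributionSpecialization
import HarnessLib

/-!
# The module `𝔻` of bounded distributions, its `M₂(ℤ)`-action and the weight-`n` specialisations

`PAdicDistributionIntegral.BoundedDistribution` packages a bounded distribution together with a
CHOSEN bound, which is data; as a consequence bounded distributions do not form an additive group
(`D + (−D)` and `0` carry different bounds).  This file introduces the honest linear-algebra object:
the `𝕜`-submodule

  `𝔻 = ProfiniteTower.distributions T 𝕜 ⊆ (Π n, T.Cell n → 𝕜)`

of level data satisfying the distribution relation and admitting SOME bound, and transports the
analysis to it:

* `toBounded` / `BoundedDistribution.μ_mem` go back and forth; the integral depends only on the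
  level data (`integralFn`, `BoundedDistribution.integral_eq_integralFn` is `rfl`), and is
  `𝕜`-linear in the distribution (`integralFn_add`, `integralFn_smul`, `integralₗ`);
* push-forward along a level-compatible family of cell maps is a linear map of level data
  (`ProfiniteTower.CellMap.push`) preserving `𝔻` (`push_mem`), functorial (`CellMap.comp`,
  `push_comp`, `push_id`), and computes integrals by change of variables (`integralFn_push`);
* on `ℤ_p × ℤ_p`: the right action of integer matrices `actD M : 𝔻 →ₗ 𝔻` (`intCellMap`,
  `intCellMap_mul`, `actD_mul : actD (M M') = actD M' ∘ actD M`, `actD_one`), and the weight-`n`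
  specialisation as a LINEAR map `specializeₗ n : 𝔻 →ₗ[ℚ_p] ℚ_p^{n+1}` which is equivariant:
  `specializeₗ n (actD M μ) = Symⁿ(M) · specializeₗ n μ` (`specializeₗ_actD`, from
  `PAdicDistributionSpecialization.specialize_linearMap_intCast`) — i.e. a morphism from the
  `M₂(ℤ)`-module `𝔻` to the coefficient modules `(ℚ_p^{n+1}, act n)` of
  `HidaOrdinaryCohomologyCocycles` (Greenberg–Stevens 1993, §1, §4: `𝔻 → Symⁿ`, the maps through
  which `𝔻`-valued cohomology specialises to every weight).

Brick B2c of the bottom-up plan recorded with the named fact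
`greenbergStevens_kitagawa_twoVariable_interpolation_allBranches`.  Everything is proved; no named facts.

## References

* R. Greenberg, G. Stevens, Invent. Math. 111 (1993), §1, §4. [GreenbergStevens1993]
* B. Mazur, J. Tate, J. Teitelbaum, Invent. Math. 84 (1986), §I.11. [MazurTateTeitelbaum1986Invent]
-/

noncomputable section

open Filter Topology Matrix

namespace Literature.NumberTheory.EllipticCurves

/-! ### The submodule of bounded distributions -/

namespace ProfiniteTower

variable {X : Type*} [PseudoMetricSpace X] (T : ProfiniteTower X) (𝕜 : Type*) [NormedField 𝕜]

/-- **The module `𝔻(T, 𝕜)` of bounded `𝕜`-valued distributions on the tower `T`**: level data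
`μ : Π n, T.Cell n → 𝕜` satisfying the distribution relation `Σ_{b ↦ a} μ_{n+1}(b) = μ_n(a)` and
bounded by some constant (Mazur–Tate–Teitelbaum 1986, §I.11; Greenberg–Stevens 1993, §1).
[cite: MazurTateTeitelbaum1986Invent, §I.11] -/
def distributions : Submodule 𝕜 ((n : ℕ) → T.Cell n → 𝕜) where
  carrier := {μ | (∀ (n : ℕ) (a : T.Cell n),
      ∑ b ∈ Finset.univ.filter (fun b : T.Cell (n + 1) => T.trans n b = a), μ (n + 1) b = μ n a) ∧
    ∃ C : ℝ, ∀ (n : ℕ) (a : T.Cell n), ‖μ n a‖ ≤ C}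
  add_mem' := by
    rintro μ ν ⟨hμ, C, hC⟩ ⟨hν, C', hC'⟩
    refine ⟨fun n a => ?_, C + C', fun n a => ?_⟩
    · simp only [Pi.add_apply, Finset.sum_add_distrib, hμ, hν]
    · exact (norm_add_le _ _).trans (add_le_add (hC n a) (hC' n a))
  zero_mem' := ⟨fun n a => by simp, 0, fun n a => by simp⟩
  smul_mem' := by
    rintro c μ ⟨hμ, C, hC⟩
    refine ⟨fun n a => ?_, ‖c‖ * C, fun n a => ?_⟩
    · simp only [Pi.smul_apply, smul_eq_mul, ← Finset.mul_sum, hμ]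
    · rw [Pi.smul_apply, Pi.smul_apply, smul_eq_mul, norm_mul]
      exact mul_le_mul_of_nonneg_left (hC n a) (norm_nonneg _)

variable {T 𝕜}

/-- Membership in `𝔻`. [folklore] -/
theorem mem_distributions_iff {μ : (n : ℕ) → T.Cell n → 𝕜} :
    μ ∈ T.distributions 𝕜 ↔ (∀ (n : ℕ) (a : T.Cell n),
      ∑ b ∈ Finset.univ.filter (fun b : T.Cell (n + 1) => T.trans n b = a), μ (n + 1) b = μ n a) ∧
    ∃ C : ℝ, ∀ (n : ℕ) (a : T.Cell n), ‖μ n a‖ ≤ C := Iff.rfl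

/-- **From `𝔻` to a bounded distribution**, choosing a (non-negative) bound. [folklore] -/
def toBounded {μ : (n : ℕ) → T.Cell n → 𝕜} (hμ : μ ∈ T.distributions 𝕜) : BoundedDistribution T 𝕜 where
  μ := μ
  sum_fiber := hμ.1
  bound := max hμ.2.choose 0
  bound_nonneg := le_max_right _ _
  norm_le n a := (hμ.2.choose_spec n a).trans (le_max_left _ _)

/-- The level data of `toBounded hμ` is `μ`. [folklore] -/
@[simp] theorem toBounded_μ {μ : (n : ℕ) → T.Cell n → 𝕜} (hμ : μ ∈ T.distributions 𝕜) :
    (toBounded hμ).μ = μ := rfl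

/-- **The integral as a function of the level data**: `lim_n Σ_a μ_n(a) f(repr a)` (junk if
divergent). [folklore] -/
def integralFn (T : ProfiniteTower X) (μ : (n : ℕ) → T.Cell n → 𝕜) (f : X → 𝕜) : 𝕜 :=
  limUnder atTop fun n => ∑ a : T.Cell n, μ n a * f (T.repr n a)

end ProfiniteTower

namespace BoundedDistribution

variable {X : Type*} [PseudoMetricSpace X] {T : ProfiniteTower X} {𝕜 : Type*} [NormedField 𝕜]
  (D : BoundedDistribution T 𝕜)

/-- The level data of a bounded distribution lie in `𝔻`. [folklore] -/
theorem μ_mem : D.μ ∈ T.distributions 𝕜 := ⟨D.sum_fiber, D.bound, D.norm_le⟩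

/-- **The integral depends only on the level data** (not on the chosen bound). [folklore] -/
theorem integral_eq_integralFn [IsUltrametricDist 𝕜] (f : X → 𝕜) :
    D.integral f = T.integralFn D.μ f := rfl

/-- Two bounded distributions with the same level data have the same integrals. [folklore] -/
theorem integral_congr_μ [IsUltrametricDist 𝕜] {D E : BoundedDistribution T 𝕜} (h : D.μ = E.μ) (f : X → 𝕜) :
    D.integral f = E.integral f := by
  rw [integral_eq_integralFn, integral_eq_integralFn, h]

/-- Riemann sums depend only on the level data. [folklore] -/
theorem riemannSum_congr_μ {D E : BoundedDistribution T 𝕜} (h : D.μ = E.μ) (f : X → 𝕜) (n : ℕ) :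
    D.riemannSum f n = E.riemannSum f n := by
  rw [riemannSum_def, riemannSum_def, h]

end BoundedDistribution

/-! ### Linearity of the integral in the distribution -/

namespace ProfiniteTower

variable {X : Type*} [PseudoMetricSpace X] {T : ProfiniteTower X} {𝕜 : Type*} [NormedField 𝕜]
  [IsUltrametricDist 𝕜] [CompleteSpace 𝕜]

/-- The Riemann sums of `μ ∈ 𝔻` converge to `integralFn μ f` for `f` uniformly continuous. [folklore] -/
theorem tendsto_sum_integralFn {μ : (n : ℕ) → T.Cell n → 𝕜} (hμ : μ ∈ T.distributions 𝕜)
    {f : X → 𝕜} (hf : UniformContinuous f) :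
    Tendsto (fun n => ∑ a : T.Cell n, μ n a * f (T.repr n a)) atTop (𝓝 (T.integralFn μ f)) :=
  (toBounded hμ).tendsto_riemannSum_integral hf

/-- **Additivity of the integral in the distribution.** [folklore] -/
theorem integralFn_add {μ ν : (n : ℕ) → T.Cell n → 𝕜} (hμ : μ ∈ T.distributions 𝕜)
    (hν : ν ∈ T.distributions 𝕜) {f : X → 𝕜} (hf : UniformContinuous f) :
    T.integralFn (μ + ν) f = T.integralFn μ f + T.integralFn ν f := by
  have h := (tendsto_sum_integralFn hμ hf).add (tendsto_sum_integralFn hν hf)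
  have h' : Tendsto (fun n => ∑ a : T.Cell n, (μ + ν) n a * f (T.repr n a)) atTop
      (𝓝 (T.integralFn μ f + T.integralFn ν f)) := by
    refine h.congr fun n => ?_
    simp only [Pi.add_apply, add_mul, Finset.sum_add_distrib]
  exact tendsto_nhds_unique (tendsto_sum_integralFn (add_mem hμ hν) hf) h'

/-- **Homogeneity of the integral in the distribution.** [folklore] -/
theorem integralFn_smul (c : 𝕜) {μ : (n : ℕ) → T.Cell n → 𝕜} (hμ : μ ∈ T.distributions 𝕜)
    {f : X → 𝕜} (hf : UniformContinuous f) :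
    T.integralFn (c • μ) f = c * T.integralFn μ f := by
  have h := (tendsto_sum_integralFn hμ hf).const_mul c
  have h' : Tendsto (fun n => ∑ a : T.Cell n, (c • μ) n a * f (T.repr n a)) atTop
      (𝓝 (c * T.integralFn μ f)) := by
    refine h.congr fun n => ?_
    simp only [Pi.smul_apply, smul_eq_mul, mul_assoc, Finset.mul_sum]
  exact tendsto_nhds_unique (tendsto_sum_integralFn (Submodule.smul_mem _ c hμ) hf) h'

variable (T) in
/-- **Integration of a uniformly continuous `f` is a linear functional on `𝔻`.** [folklore] -/
def integralₗ {f : X → 𝕜} (hf : UniformContinuous f) : T.distributions 𝕜 →ₗ[𝕜] 𝕜 where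
  toFun μ := T.integralFn μ.1 f
  map_add' μ ν := by
    rw [Submodule.coe_add]
    exact integralFn_add μ.2 ν.2 hf
  map_smul' c μ := by
    rw [Submodule.coe_smul, RingHom.id_apply, smul_eq_mul]
    exact integralFn_smul c μ.2 hf

/-- Unfolding lemma for `integralₗ`. [folklore] -/
theorem integralₗ_apply {f : X → 𝕜} (hf : UniformContinuous f) (μ : T.distributions 𝕜) :
    integralₗ T hf μ = T.integralFn μ.1 f := rfl

end ProfiniteTower

/-! ### Push-forward as a linear map of level data -/

namespace ProfiniteTower.CellMap

variable {X X' X'' : Type*} [PseudoMetricSpace X] [PseudoMetricSpace X'] [PseudoMetricSpace X'']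
  {T : ProfiniteTower X} {T' : ProfiniteTower X'} {T'' : ProfiniteTower X''}
  {𝕜 : Type*} [NormedField 𝕜]

/-- Two level-compatible families with the same maps are equal. [folklore] -/
theorem ext' {φ ψ : T.CellMap T'} (h : ∀ (n : ℕ) (a : T.Cell n), φ.map n a = ψ.map n a) : φ = ψ := by
  obtain ⟨f, hf⟩ := φ
  obtain ⟨g, hg⟩ := ψ
  have : f = g := funext fun n => funext fun a => h n a
  subst this
  rfl

/-- The identity family. [folklore] -/
protected def id (T : ProfiniteTower X) : T.CellMap T where
  map _ a := a
  map_trans _ _ := rfl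

/-- Composition of level-compatible families. [folklore] -/
def comp (ψ : T'.CellMap T'') (φ : T.CellMap T') : T.CellMap T'' where
  map n a := ψ.map n (φ.map n a)
  map_trans n b := by rw [φ.map_trans, ψ.map_trans]

/-- The maps of the identity family. [folklore] -/
@[simp] theorem id_map (n : ℕ) (a : T.Cell n) : (CellMap.id T).map n a = a := rfl

/-- The maps of a composite family. [folklore] -/
@[simp] theorem comp_map (ψ : T'.CellMap T'') (φ : T.CellMap T') (n : ℕ) (a : T.Cell n) :
    (ψ.comp φ).map n a = ψ.map n (φ.map n a) := rfl

variable (𝕜) in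
/-- **Push-forward of level data** along `φ`: `(φ_* μ)_n(a') = Σ_{φ_n a = a'} μ_n(a)`, a linear map.
[folklore] -/
def push (φ : T.CellMap T') : ((n : ℕ) → T.Cell n → 𝕜) →ₗ[𝕜] ((n : ℕ) → T'.Cell n → 𝕜) where
  toFun μ n a' := ∑ a ∈ Finset.univ.filter (fun a : T.Cell n => φ.map n a = a'), μ n a
  map_add' μ ν := by
    funext n a'
    simp only [Pi.add_apply, Finset.sum_add_distrib]
  map_smul' c μ := by
    funext n a'
    simp only [Pi.smul_apply, smul_eq_mul, RingHom.id_apply, Finset.mul_sum]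

/-- Unfolding lemma for `push`. [folklore] -/
theorem push_apply (φ : T.CellMap T') (μ : (n : ℕ) → T.Cell n → 𝕜) (n : ℕ) (a' : T'.Cell n) :
    φ.push 𝕜 μ n a' = ∑ a ∈ Finset.univ.filter (fun a : T.Cell n => φ.map n a = a'), μ n a := rfl

/-- The level data of `BoundedDistribution.map` are the push-forward of the level data. [folklore] -/
theorem _root_.Literature.NumberTheory.EllipticCurves.BoundedDistribution.map_μ_eq_push
    [IsUltrametricDist 𝕜] (D : BoundedDistribution T 𝕜) (φ : T.CellMap T') :
    (D.map φ).μ = φ.push 𝕜 D.μ := rfl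

/-- **Push-forward preserves `𝔻`** (values in a non-archimedean field). [folklore] -/
theorem push_mem [IsUltrametricDist 𝕜] (φ : T.CellMap T') {μ : (n : ℕ) → T.Cell n → 𝕜}
    (hμ : μ ∈ T.distributions 𝕜) : φ.push 𝕜 μ ∈ T'.distributions 𝕜 :=
  ((toBounded hμ).map φ).μ_mem

/-- **Functoriality**: `(ψ ∘ φ)_* = ψ_* ∘ φ_*`. [folklore] -/
theorem push_comp (ψ : T'.CellMap T'') (φ : T.CellMap T') :
    (ψ.comp φ).push 𝕜 = (ψ.push 𝕜).comp (φ.push 𝕜) := by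
  classical
  refine LinearMap.ext fun μ => funext fun n => funext fun a'' => ?_
  rw [LinearMap.comp_apply, push_apply, push_apply]
  simp only [push_apply, comp_map]
  rw [Finset.sum_fiberwise_eq_sum_filter]
  refine Finset.sum_congr ?_ fun _ _ => rfl
  ext a
  simp only [Finset.mem_filter, Finset.mem_univ, true_and]

/-- `id_* = id`. [folklore] -/
theorem push_id : (CellMap.id T).push 𝕜 = LinearMap.id := by
  classical
  refine LinearMap.ext fun μ => funext fun n => funext fun a => ?_
  rw [push_apply, LinearMap.id_apply]
  rw [Finset.sum_eq_single_of_mem a (by simp) fun b hb hba => absurd (by simpa using hb) hba]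

/-- **Change of variables on `𝔻`**: `∫ f d(φ_* μ) = ∫ (f ∘ Φ) dμ` for `Φ` over `φ`. [folklore] -/
theorem integralFn_push [IsUltrametricDist 𝕜] [CompleteSpace 𝕜] (φ : T.CellMap T')
    {μ : (n : ℕ) → T.Cell n → 𝕜} (hμ : μ ∈ T.distributions 𝕜) {Φ : X → X'}
    (hΦ : ∀ (n : ℕ) (x : X), T'.proj n (Φ x) = φ.map n (T.proj n x))
    {f : X' → 𝕜} (hf : UniformContinuous f) (hfΦ : UniformContinuous (f ∘ Φ)) :
    T'.integralFn (φ.push 𝕜 μ) f = T.integralFn μ (f ∘ Φ) :=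
  (toBounded hμ).integral_map φ hΦ hf hfΦ

end ProfiniteTower.CellMap

/-! ### The right action of integer matrices on `𝔻(ℤ_p × ℤ_p)` and the weight specialisations -/

section IntAction

variable {p : ℕ} [Fact p.Prime]

variable (p) in
/-- The level maps of the right action of an integer matrix `M` on `ℤ_p × ℤ_p`,
`(x, y) ↦ (x, y)·M`. [folklore] -/
def intCellMap (M : Matrix (Fin 2) (Fin 2) ℤ) : (padicIntSq p).CellMap (padicIntSq p) :=
  ProfiniteTower.linearCellMap p (M 0 0) (M 0 1) (M 1 0) (M 1 1)

/-- The level maps of `intCellMap`. [folklore] -/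
theorem intCellMap_map (M : Matrix (Fin 2) (Fin 2) ℤ) (n : ℕ) (v : ZMod (p ^ n) × ZMod (p ^ n)) :
    (intCellMap p M).map n v = ((M 0 0 : ZMod (p ^ n)) * v.1 + (M 1 0 : ZMod (p ^ n)) * v.2,
      (M 0 1 : ZMod (p ^ n)) * v.1 + (M 1 1 : ZMod (p ^ n)) * v.2) := by
  rw [intCellMap, ProfiniteTower.linearCellMap_map, linMapMod_apply]
  simp only [map_intCast]

/-- **The level maps compose like the matrices** (a right action): `(v·M)·M' = v·(M M')`.
[folklore] -/
theorem intCellMap_mul (M M' : Matrix (Fin 2) (Fin 2) ℤ) :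
    intCellMap p (M * M') = (intCellMap p M').comp (intCellMap p M) := by
  refine ProfiniteTower.CellMap.ext' fun n v => ?_
  rw [ProfiniteTower.CellMap.comp_map, intCellMap_map, intCellMap_map, intCellMap_map]
  simp only [Matrix.mul_apply, Fin.sum_univ_two, Int.cast_add, Int.cast_mul]
  refine Prod.ext ?_ ?_ <;> dsimp only <;> ring

/-- The identity matrix acts trivially. [folklore] -/
theorem intCellMap_one : intCellMap p (1 : Matrix (Fin 2) (Fin 2) ℤ) = ProfiniteTower.CellMap.id _ := by
  refine ProfiniteTower.CellMap.ext' fun n v => ?_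
  rw [intCellMap_map, ProfiniteTower.CellMap.id_map]
  simp

variable {𝕜 : Type*} [NormedField 𝕜] [IsUltrametricDist 𝕜]

variable (p 𝕜) in
/-- **The right action `μ ↦ μ·M` of `M ∈ M₂(ℤ)` on `𝔻(ℤ_p × ℤ_p)`** (push-forward along
`(x, y) ↦ (x, y)·M`; Greenberg–Stevens 1993, §1). [cite: GreenbergStevens1993, §1] -/
def actD (M : Matrix (Fin 2) (Fin 2) ℤ) :
    (padicIntSq p).distributions 𝕜 →ₗ[𝕜] (padicIntSq p).distributions 𝕜 :=
  ((intCellMap p M).push 𝕜).restrict fun _ hμ => ProfiniteTower.CellMap.push_mem _ hμ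

/-- Unfolding lemma for `actD`. [folklore] -/
@[simp] theorem coe_actD (M : Matrix (Fin 2) (Fin 2) ℤ) (μ : (padicIntSq p).distributions 𝕜) :
    ((actD p 𝕜 M μ : (padicIntSq p).distributions 𝕜) : (n : ℕ) → (padicIntSq p).Cell n → 𝕜) =
      (intCellMap p M).push 𝕜 μ := rfl

/-- **`actD` is a right action**: `actD (M M') = actD M' ∘ actD M`. [folklore] -/
theorem actD_mul (M M' : Matrix (Fin 2) (Fin 2) ℤ) :
    actD p 𝕜 (M * M') = (actD p 𝕜 M').comp (actD p 𝕜 M) := by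
  refine LinearMap.ext fun μ => Subtype.ext ?_
  rw [coe_actD, LinearMap.comp_apply, coe_actD, coe_actD, intCellMap_mul,
    ProfiniteTower.CellMap.push_comp, LinearMap.comp_apply]

/-- `actD (M M') μ = actD M' (actD M μ)`. [folklore] -/
theorem actD_mul_apply (M M' : Matrix (Fin 2) (Fin 2) ℤ) (μ : (padicIntSq p).distributions 𝕜) :
    actD p 𝕜 (M * M') μ = actD p 𝕜 M' (actD p 𝕜 M μ) := by
  rw [actD_mul]; rfl

/-- `actD 1 = id`. [folklore] -/
@[simp] theorem actD_one : actD p 𝕜 (1 : Matrix (Fin 2) (Fin 2) ℤ) = LinearMap.id := by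
  refine LinearMap.ext fun μ => Subtype.ext ?_
  rw [coe_actD, intCellMap_one, ProfiniteTower.CellMap.push_id]
  rfl

/-- The bounded distribution `toBounded (actD M μ)` has the level data of
`(toBounded μ).linearMap …`. [folklore] -/
theorem toBounded_actD_μ (M : Matrix (Fin 2) (Fin 2) ℤ) (μ : (padicIntSq p).distributions 𝕜) :
    (ProfiniteTower.toBounded (actD p 𝕜 M μ).2).μ =
      ((ProfiniteTower.toBounded μ.2).linearMap (M 0 0) (M 0 1) (M 1 0) (M 1 1)).μ := rfl

variable (p) in
/-- **The weight-`n` specialisation as a linear map `𝔻 → ℚ_p^{n+1}`.**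
[cite: GreenbergStevens1993, §4 (4.6)] -/
def specializeₗ (n : ℕ) : (padicIntSq p).distributions ℚ_[p] →ₗ[ℚ_[p]] (Fin (n + 1) → ℚ_[p]) where
  toFun μ := (ProfiniteTower.toBounded μ.2).specialize n
  map_add' μ ν := by
    funext i
    simp only [Pi.add_apply, BoundedDistribution.specialize_apply,
      BoundedDistribution.integral_eq_integralFn, ProfiniteTower.toBounded_μ, Submodule.coe_add]
    rw [ProfiniteTower.integralFn_add μ.2 ν.2 (uniformContinuous_coe_monomial _ _), mul_add]
  map_smul' c μ := by
    funext i
    simp only [Pi.smul_apply, smul_eq_mul, RingHom.id_apply, BoundedDistribution.specialize_apply,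
      BoundedDistribution.integral_eq_integralFn, ProfiniteTower.toBounded_μ, Submodule.coe_smul]
    rw [ProfiniteTower.integralFn_smul c μ.2 (uniformContinuous_coe_monomial _ _)]
    ring

/-- Unfolding lemma for `specializeₗ`. [folklore] -/
theorem specializeₗ_apply (n : ℕ) (μ : (padicIntSq p).distributions ℚ_[p]) :
    specializeₗ p n μ = (ProfiniteTower.toBounded μ.2).specialize n := rfl

/-- The specialisation depends only on the level data. [folklore] -/
theorem _root_.Literature.NumberTheory.EllipticCurves.BoundedDistribution.specialize_congr_μ
    {D E : BoundedDistribution (padicIntSq p) ℚ_[p]} (h : D.μ = E.μ) (n : ℕ) :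
    D.specialize n = E.specialize n := by
  funext i
  rw [BoundedDistribution.specialize_apply, BoundedDistribution.specialize_apply,
    BoundedDistribution.integral_congr_μ h]

/-- **Equivariance of the weight-`n` specialisation on `𝔻`**:
`specializeₗ n (μ·M) = Symⁿ(M) · specializeₗ n μ` — the specialisation is a morphism from the
`M₂(ℤ)`-module `𝔻` to `(ℚ_p^{n+1}, a ↦ Symⁿ(M) a)`, the coefficient module `act n M` of
`HidaOrdinaryCohomologyCocycles` (Greenberg–Stevens 1993, (4.6)–(4.8)).
[cite: GreenbergStevens1993, §4 (4.6)–(4.8)] -/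
theorem specializeₗ_actD (n : ℕ) (M : Matrix (Fin 2) (Fin 2) ℤ) (μ : (padicIntSq p).distributions ℚ_[p]) :
    specializeₗ p n (actD p ℚ_[p] M μ) =
      ModularForms.HidaCohomology.symPow n (M.map (Int.castRingHom ℚ_[p])) *ᵥ specializeₗ p n μ := by
  rw [specializeₗ_apply, specializeₗ_apply,
    BoundedDistribution.specialize_congr_μ (toBounded_actD_μ M μ) n,
    BoundedDistribution.specialize_linearMap_intCast]

end IntAction

end Literature.NumberTheory.EllipticCurves

end
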